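import Summits.Ventures.HSemireg.Pad4TowerPermCovariance


/-!
# Venture HSemireg — PAD-4 on 𝔅(μ₄): LEMMA P, part 2 — THE STATIC GAME IS `S₄`-COVARIANT, AND THE `G₁`-HULL OF A SUPPORT (plan-lens-HodgeAV-negation g2)

HONEST FRAMING. As part 1 (`Pad4TowerPermCovariance.lean`): Lean index of the computation cell `pub-hsemireg` (S4-PUSH, H2 door PAD-4, line
stmt-HodgeConjecture-18881), lens seat `plan-lens-HodgeAV-negation` g2, carved out of the crux Sketch `Cruxes∕BlochSeedDiscOne∕GhostMateThinning.lean` §4–§5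
(ec1716aae19efc4e) on the critic's price G3 (idea-crit-6 L6; director R16.29∕R16.30). Census-neutral: theorems ABOUT THE TYPED STATIC PREDICATES of record
(`RuleDMu4Closed` of `Pad4TowerRuleDMu4`; `XMinusClosed`, `XPlusClosed`, `A2IMinusClosed`, `A2IPlusClosed` of `Pad4TowerXresFamilies`; `InDiamond` of
`Pad4TowerDiamondMu4`; `StaticH1` ∕ `StaticFour` ∕ `G1Closed` of `Pad4TowerSeedB1`); nothing here is an object, a σ, a seed or a census row; NOTHING HERE SAYS
THAT HC ∕ HC_CM ∕ HC_AV ∕ H2 HOLDS OR FAILS. No `sorry`, no `axiom`, no `instance`, no notation, no Literature fact.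

WHAT. **THEOREM (`staticFamilies_permInvariant_familywise`, §4): for every `τ ∈ S₄` and every configuration `C`, each of `RuleDMu4Closed`,
`XMinusClosed`, `XPlusClosed`, `A2IMinusClosed`, `A2IPlusClosed` holds on `C.permImage τ` iff it holds on `C`, and so does every `InDiamond h`;** hence
`StaticH1` and `StaticFour` (`staticH1_permImage`, `staticFour_permImage`; and `staticFour_phaseImage`, the torus companion LEMMA T leaves implicit).
Together with LEMMA T (`Pad4TowerTorusBlind.staticFamilies_torusInvariant_familywise`, the factorwise torus `(ℤ∕4)⁴ ⊇ ⟨Δ⟩`) the whole static game of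
record is invariant under `(ℤ∕4) ≀ S₄ ⊇ G₁ = ⟨Δ⟩ × S₄` — the symmetry the census encoder's orbit mode (`xres2s.py` v18+ `JOB_ORBIT=g1`, bc5-plan g8;
numerically self-tested there, «self-check 540∕0») quotients by. PROOF (§3): with part 1's `magree_perm` ∕ `magree2_perm`, the predicates `Sibling`, `NoCompanion`, `HeOkP` ∕ `HbOkP`,
the A2I escapes and `WfEmpty` re-index under `τ` (the factor quantifiers INSIDE the predicates bijectively: `forall_perm_index` ∕ `exists_perm_index`),
so `XresXFires` ∕ `XresA2IFires` on `C.permImage τ` at `(Z.perm τ; q.perm τ, …; τ⁻¹ σ, …)` is `XresXFires` ∕ `XresA2IFires` on `C`; the dual of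
`Pad4TowerRuleDMu4Dual` commutes with the permutation (`dual_permImage`), which transports X⁻ ∕ A2I⁻ to X⁺ ∕ A2I⁺. §5 builds the **`G₁`-HULL**
`satG1 C = ⟨Δ⟩·(S₄·C)` of an arbitrary two-level support and proves: `C ⊆ satG1 C` levelwise (`sub_satG1`), the hull is `G₁`-closed (`g1Closed_satG1`),
lies in the same diamond (`inDiamond_satG1`), is RULE-D-closed when `C` is (`ruleDMu4Closed_satG1` — covariance + the tree's monotonicity
`ruleDMu4N_mono` ∕ `ruleDMu4P_mono`), and is the LEAST `G₁`-closed support above `C` (`satG1_sub`, `satG1_eq_of_g1Closed`). (The instance families X ∕ A2I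
are NOT monotone in the support, so no hull statement is claimed for them.)

WHY IT MATTERS (crux idea `Cruxes∕BlochSeedDiscOne∕Ideas∕ghost-mate-thinning.md`, critic memo verdicts∕13 on 18881): (i) the census rows of record
(W16 ∕ W17 ∕ W18 = j298438 ∕ j302131 ∕ j305149, (W′) j310554, W19 ∕ W22 at ◇₁₀) are computed on `G₁`-ORBIT variables; LEMMA T + LEMMA P are the kernel
certificate that every static family of record is a `G₁`-INVARIANT condition on the support; (ii) for a FLAT (asymmetric) support `C ⊆ ◇₈` the hull
`satG1 C` is a ◇₈ ∕ `G₁`-closed ∕ RULE-D-closed support containing `C`, so the `G₁`-seed [S] `SeedB1Diamond8G1H1` (hypothesis form, `Pad4TowerSeedB1`)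
applies to the HULL — the «ghost-mate descent» of the negation line (`GhostMateThinning.flatSeed_iff_killedHullThinning`, Cruxes side, not repeated here).

SOURCES: part 1; `Pad4TowerCrossPhase.lean` ∕ `Pad4TowerXStaticSafe2.lean` ∕ `Pad4TowerXresFamilies.lean` (X ∕ A2I families), `Pad4TowerSeedB1.lean`
(`StaticH1`, `StaticFour`, `G1Closed`), `Pad4TowerDeltaWindow.lean` ∕ `Pad4TowerPermWindow.lean` (`DeltaClosed`, `PermClosed`), `Pad4TowerStaticTorus.lean`
(`MConfig.phaseImage`, `MCell.inDiamond_phase_iff`), `Pad4TowerTorusBlind.lean` (LEMMA T §5–§6, mirrored line by line in §3 with `perm` for `phase`);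
negation-seat Sketch `GhostMateThinning.lean` ec1716aae19efc4e §5 (the hull part, farm-checked there first; §3 is new here). -/

namespace Summit.Ventures.HSemireg.Pad4Tower

open Finset

/-! ## §3 The X and A2I families are `S₄`-covariant (new; mirrors LEMMA T §5–§6 with `perm` for `phase`) -/

section PermFamilies

variable (τ : Equiv.Perm (Fin 4)) (C : MConfig)

/-- re-indexing a universal factor quantifier along `τ`. -/
theorem forall_perm_index {p : Fin 4 → Prop} : (∀ g, p (τ g)) ↔ ∀ g, p g :=
  ⟨fun h g => by simpa only [Equiv.apply_symm_apply] using h (τ.symm g), fun h g => h (τ g)⟩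

/-- re-indexing an existential factor quantifier along `τ`. -/
theorem exists_perm_index {p : Fin 4 → Prop} : (∃ g, p (τ g)) ↔ ∃ g, p g :=
  ⟨fun ⟨g, h⟩ => ⟨τ g, h⟩, fun ⟨g, h⟩ => ⟨τ.symm g, by simpa only [Equiv.apply_symm_apply] using h⟩⟩

/-- `S₄` covariance: `sibling_perm` (the factor index moves, the direction does not). -/
theorem sibling_perm (q n : MCell) (σ w : Fin 4) : Sibling (q.perm τ) (n.perm τ) σ w ↔ Sibling q n (τ σ) w := by
  simp only [Sibling, magree_perm, MCell.perm_apply]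

/-- `S₄` covariance: `noCompanion_perm`. -/
theorem noCompanion_perm (q n : MCell) (σ w : Fin 4) :
    NoCompanion (C.permImage τ) (q.perm τ) (n.perm τ) σ w ↔ NoCompanion C q n (τ σ) w := by
  simp only [NoCompanion, forall_permImage_upper, magree_perm, MCell.perm_apply]

/-- `S₄` covariance: `heOkP_perm`. -/
theorem heOkP_perm (Z q n : MCell) (σ : Fin 4) :
    HeOkP (C.permImage τ) (Z.perm τ) (q.perm τ) (n.perm τ) σ ↔ HeOkP C Z q n (τ σ) := by
  simp only [HeOkP, forall_permImage_upper, magree_perm, MCell.perm_apply]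

/-- `S₄` covariance: `hbOkP_perm`. -/
theorem hbOkP_perm (Z n : MCell) (σ f : Fin 4) :
    HbOkP (C.permImage τ) (Z.perm τ) (n.perm τ) σ f ↔ HbOkP C Z n (τ σ) (τ f) := by
  simp only [HbOkP, forall_permImage_upper, magree2_perm, MCell.perm_apply]

/-- `S₄` covariance: `wfEmpty_perm` (the inner factor quantifier is re-indexed). -/
theorem wfEmpty_perm (Z : MCell) (f : Fin 4) : WfEmpty (C.permImage τ) (Z.perm τ) f ↔ WfEmpty C Z (τ f) := by
  simp only [WfEmpty, forall_permImage_upper, magree_perm, magree2_perm, MCell.perm_apply]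
  refine forall_congr' fun P => forall_congr' fun _ => imp_congr Iff.rfl (and_congr Iff.rfl ?_)
  rw [← forall_perm_index τ (p := fun g => g ≠ τ f → MAgree2 P Z (τ f) g → ¬ NullBelow (P g) (Z g))]
  simp only [ne_eq, EmbeddingLike.apply_eq_iff_eq]

/-- one X instance, permuted (head factor `σ ↦ τ σ`, free factor `f ↦ τ f`; directions `u`, `w` unchanged). -/
theorem xresXFires_perm (Z q n : MCell) (σ u w f : Fin 4) :
    XresXFires (C.permImage τ) (Z.perm τ) (q.perm τ) (n.perm τ) σ u w f ↔ XresXFires C Z q n (τ σ) u w (τ f) := by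
  simp only [XresXFires, uPartner_perm, sibling_perm, noCompanion_perm, heOkP_perm, hbOkP_perm, wfEmpty_perm,
    forall_permImage_upper, MCell.perm_apply, ne_eq, EmbeddingLike.apply_eq_iff_eq]

/-- **the X family (X⁻ reading) is `S₄`-covariant.** -/
theorem xresXClosed_permImage : XresXClosed (C.permImage τ) ↔ XresXClosed C := by
  simp only [XresXClosed, forall_permImage_lower, forall_permImage_upper, xresXFires_perm]
  constructor
  · intro h Z hZ q hq n hn σ u w f
    simpa only [Equiv.apply_symm_apply] using h Z hZ q hq n hn (τ.symm σ) u w (τ.symm f)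
  · intro h Z hZ q hq n hn σ u w f
    exact h Z hZ q hq n hn (τ σ) u w (τ f)

/-- **X⁻ is `S₄`-covariant.** -/
theorem xMinusClosed_permImage : XMinusClosed (C.permImage τ) ↔ XMinusClosed C := xresXClosed_permImage τ C

/-- the dual commutes with the factor permutation, on cells … -/
theorem dualCell_perm (t : ℤ) (Z : MCell) : dualCell t (Z.perm τ) = (dualCell t Z).perm τ := rfl

/-- … and on configurations. -/
theorem dual_permImage (t : ℤ) : (C.permImage τ).dual t = (C.dual t).permImage τ := by
  simp only [MConfig.dual, MConfig.permImage, Finset.image_image]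
  rfl

/-- **X⁺ (the dual reading) is `S₄`-covariant.** -/
theorem xPlusClosed_permImage : XPlusClosed (C.permImage τ) ↔ XPlusClosed C := by
  rw [XPlusClosed, dual_permImage, xresXClosed_permImage]

/-- the (H-e′)-type escape of an A2I instance with its inner factor quantifier, permuted. -/
theorem a2iEscapeE_perm (P Z : MCell) (f' v : Fin 4) :
    (NullBelow (P (τ f')) (Z (τ f')) →
        (MAgree P Z (τ f') ∨ ∃ g : Fin 4, g ≠ f' ∧ MAgree2 P Z (τ f') (τ g) ∧ NullBelow (P (τ g)) (Z (τ g))) →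
          Z (τ f') = ray (P (τ f')) v ((Z (τ f')).1 - (P (τ f')).1)) ↔
      (NullBelow (P (τ f')) (Z (τ f')) →
        (MAgree P Z (τ f') ∨ ∃ g : Fin 4, g ≠ τ f' ∧ MAgree2 P Z (τ f') g ∧ NullBelow (P g) (Z g)) →
          Z (τ f') = ray (P (τ f')) v ((Z (τ f')).1 - (P (τ f')).1)) := by
  refine imp_congr Iff.rfl (imp_congr (or_congr Iff.rfl ?_) Iff.rfl)
  rw [← exists_perm_index τ (p := fun g => g ≠ τ f' ∧ MAgree2 P Z (τ f') g ∧ NullBelow (P g) (Z g))]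
  simp only [ne_eq, EmbeddingLike.apply_eq_iff_eq]

/-- the (H-b)-type escape of an A2I instance with its inner factor quantifier, permuted. -/
theorem a2iEscapeB_perm (P Z : MCell) (σ f' : Fin 4) :
    (∀ g : Fin 4, g ≠ σ → g ≠ f' → P (τ g) = Z (τ g)) ↔ ∀ g : Fin 4, g ≠ τ σ → g ≠ τ f' → P g = Z g := by
  rw [← forall_perm_index τ (p := fun g => g ≠ τ σ → g ≠ τ f' → P g = Z g)]
  simp only [ne_eq, EmbeddingLike.apply_eq_iff_eq]

/-- one A2I instance, permuted (head factor `σ ↦ τ σ`, escort factor `f' ↦ τ f'`; directions `u`, `v` unchanged). -/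
theorem xresA2IFires_perm (Z q N' : MCell) (σ u f' v : Fin 4) :
    XresA2IFires (C.permImage τ) (Z.perm τ) (q.perm τ) (N'.perm τ) σ u f' v ↔ XresA2IFires C Z q N' (τ σ) u (τ f') v := by
  simp only [XresA2IFires, uPartner_perm, forall_permImage_upper, magree_perm, magree2_perm, MCell.perm_apply]
  refine and_congr_right fun _ => and_congr_right fun _ => and_congr_right fun _ => and_congr_right fun _ => ?_
  refine and_congr (by simp only [ne_eq, EmbeddingLike.apply_eq_iff_eq]) ?_
  refine and_congr_right fun _ => and_congr_right fun _ => and_congr_right fun _ => and_congr_right fun _ => ?_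
  refine and_congr (forall_congr' fun P => forall_congr' fun _ => a2iEscapeE_perm τ P Z f' v) ?_
  exact forall_congr' fun P => forall_congr' fun _ => imp_congr (a2iEscapeB_perm τ P Z σ f') Iff.rfl

/-- **the A2I family (A2I⁻ reading) is `S₄`-covariant.** -/
theorem xresA2IClosed_permImage : XresA2IClosed (C.permImage τ) ↔ XresA2IClosed C := by
  simp only [XresA2IClosed, forall_permImage_lower, forall_permImage_upper, xresA2IFires_perm]
  constructor
  · intro h Z hZ q hq N' hN' σ u f' v
    simpa only [Equiv.apply_symm_apply] using h Z hZ q hq N' hN' (τ.symm σ) u (τ.symm f') v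
  · intro h Z hZ q hq N' hN' σ u f' v
    exact h Z hZ q hq N' hN' (τ σ) u (τ f') v

/-- **A2I⁻ is `S₄`-covariant.** -/
theorem a2iMinusClosed_permImage : A2IMinusClosed (C.permImage τ) ↔ A2IMinusClosed C := xresA2IClosed_permImage τ C

/-- **A2I⁺ (the dual reading) is `S₄`-covariant.** -/
theorem a2iPlusClosed_permImage : A2IPlusClosed (C.permImage τ) ↔ A2IPlusClosed C := by
  rw [A2IPlusClosed, dual_permImage, xresA2IClosed_permImage]

end PermFamilies

/-! ## §4 LEMMA P assembled -/

/-- the permuted support lies in the same diamond, and conversely. -/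
theorem inDiamond_permImage_iff (τ : Equiv.Perm (Fin 4)) (C : MConfig) (h : ℤ) : (C.permImage τ).InDiamond h ↔ C.InDiamond h := by
  refine ⟨fun hU => ⟨fun Z hZ f => ?_, fun P hP f => ?_⟩, inDiamond_permImage τ C⟩
  · simpa only [MCell.perm_apply, Equiv.apply_symm_apply] using hU.1 _ ((perm_mem_permImage_lower τ C).mpr hZ) (τ.symm f)
  · simpa only [MCell.perm_apply, Equiv.apply_symm_apply] using hU.2 _ ((perm_mem_permImage_upper τ C).mpr hP) (τ.symm f)

/-- **LEMMA P (THE STATIC GAME IS `S₄`-COVARIANT, familywise).** For every factor permutation `τ` and every two-level configuration, each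
static family of record and every diamond universe is invariant under `C ↦ C.permImage τ`. (The `S₄` half of `G₁ = ⟨Δ⟩ × S₄`; the `⟨Δ⟩` half —
indeed the whole factorwise torus — is LEMMA T `staticFamilies_torusInvariant_familywise`.) -/
theorem staticFamilies_permInvariant_familywise (τ : Equiv.Perm (Fin 4)) (C : MConfig) :
    (RuleDMu4Closed (C.permImage τ) ↔ RuleDMu4Closed C) ∧ (XMinusClosed (C.permImage τ) ↔ XMinusClosed C) ∧
    (XPlusClosed (C.permImage τ) ↔ XPlusClosed C) ∧ (A2IMinusClosed (C.permImage τ) ↔ A2IMinusClosed C) ∧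
    (A2IPlusClosed (C.permImage τ) ↔ A2IPlusClosed C) ∧ ∀ h : ℤ, (C.permImage τ).InDiamond h ↔ C.InDiamond h :=
  ⟨ruleDMu4Closed_permImage τ C, xMinusClosed_permImage τ C, xPlusClosed_permImage τ C, a2iMinusClosed_permImage τ C,
    a2iPlusClosed_permImage τ C, inDiamond_permImage_iff τ C⟩

/-- `StaticH1` (`H₁ = {X+, A2I−}` + RULE D) is kept by every factor permutation. -/
theorem staticH1_permImage (τ : Equiv.Perm (Fin 4)) (C : MConfig) : (C.permImage τ).StaticH1 ↔ C.StaticH1 := by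
  simp only [MConfig.StaticH1, ruleDMu4Closed_permImage, xPlusClosed_permImage, a2iMinusClosed_permImage]

/-- `StaticFour` (RULE D + all four instance families) is kept by every factor permutation. -/
theorem staticFour_permImage (τ : Equiv.Perm (Fin 4)) (C : MConfig) : (C.permImage τ).StaticFour ↔ C.StaticFour := by
  simp only [MConfig.StaticFour, XresFourClosed, ruleDMu4Closed_permImage, xMinusClosed_permImage, xPlusClosed_permImage,
    a2iMinusClosed_permImage, a2iPlusClosed_permImage]

/-- … and by every factorwise phase rotation (LEMMA T, bundled for `StaticFour`). -/
theorem staticFour_phaseImage (η : PVec) (C : MConfig) : (C.phaseImage η).StaticFour ↔ C.StaticFour := by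
  simp only [MConfig.StaticFour, XresFourClosed, ruleDMu4Closed_phaseImage, xMinusClosed_phaseImage, xPlusClosed_phaseImage,
    a2iMinusClosed_phaseImage, a2iPlusClosed_phaseImage]

/-! ## §5 The `G₁`-hull of a two-level support -/

/-- the `S₄`-saturation of a two-level support. -/
def satPerm (C : MConfig) : MConfig :=
  ⟨univ.biUnion fun τ => C.lower.image (MCell.perm τ), univ.biUnion fun τ => C.upper.image (MCell.perm τ)⟩

/-- the constant phase vector `(k,k,k,k)` (`k = 1`: `Δ`). -/
def cvec (k : Fin 4) : PVec := fun _ => k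

/-- the `⟨Δ⟩`-saturation of a two-level support (`Δ = MCell.delta = phase (1,1,1,1)`). -/
def satDelta (C : MConfig) : MConfig :=
  ⟨univ.biUnion fun k => C.lower.image (MCell.phase (cvec k)), univ.biUnion fun k => C.upper.image (MCell.phase (cvec k))⟩

/-- **the `G₁`-hull** `G₁·C`, `G₁ = S₄ × ⟨Δ⟩`. -/
def satG1 (C : MConfig) : MConfig := satDelta (satPerm C)

/-- membership in the saturation `sat S φs` of a cell set by a list of cell maps: the cell is the image of a member of `S` under one of the listed maps. -/
theorem mem_sat_iff {ι : Type*} [Fintype ι] (S : Finset MCell) (φ : ι → MCell → MCell) (X : MCell) :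
    X ∈ univ.biUnion (fun i => S.image (φ i)) ↔ ∃ i, ∃ Z ∈ S, φ i Z = X := by
  simp [Finset.mem_biUnion, Finset.mem_image]

/-- a cell set is contained in its saturation as soon as the identity map is among the listed maps. -/
theorem subset_sat {ι : Type*} [Fintype ι] (S : Finset MCell) (φ : ι → MCell → MCell) (i : ι) :
    S.image (φ i) ⊆ univ.biUnion (fun i => S.image (φ i)) :=
  Finset.subset_biUnion_of_mem (fun i => S.image (φ i)) (Finset.mem_univ i)

/-- `C` is levelwise contained in its `S₄`-saturation `satPerm C`. -/
theorem sub_satPerm (C : MConfig) : C.sub (satPerm C) := by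
  refine ⟨fun Z hZ => ?_, fun P hP => ?_⟩
  · exact subset_sat C.lower (fun τ => MCell.perm τ) 1 (Finset.mem_image.mpr ⟨Z, hZ, MCell.perm_one Z⟩)
  · exact subset_sat C.upper (fun τ => MCell.perm τ) 1 (Finset.mem_image.mpr ⟨P, hP, MCell.perm_one P⟩)

/-- every factor permutation of `C` is levelwise contained in the `S₄`-saturation `satPerm C`. -/
theorem permImage_sub_satPerm (C : MConfig) (τ : Equiv.Perm (Fin 4)) : (C.permImage τ).sub (satPerm C) :=
  ⟨subset_sat C.lower (fun τ => MCell.perm τ) τ, subset_sat C.upper (fun τ => MCell.perm τ) τ⟩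

/-- the diagonal phase vector `cvec 0` acts trivially: `Z.phase (cvec 0) = Z`. -/
theorem phase_cvec_zero (Z : MCell) : Z.phase (cvec 0) = Z := rfl

/-- `C` is levelwise contained in its diagonal-torus saturation `satDelta C`. -/
theorem sub_satDelta (C : MConfig) : C.sub (satDelta C) := by
  refine ⟨fun Z hZ => ?_, fun P hP => ?_⟩
  · exact subset_sat C.lower (fun k => MCell.phase (cvec k)) 0 (Finset.mem_image.mpr ⟨Z, hZ, phase_cvec_zero Z⟩)
  · exact subset_sat C.upper (fun k => MCell.phase (cvec k)) 0 (Finset.mem_image.mpr ⟨P, hP, phase_cvec_zero P⟩)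

/-- every diagonal phase image `C.phaseImage (cvec k)` is levelwise contained in `satDelta C`. -/
theorem phaseImage_sub_satDelta (C : MConfig) (k : Fin 4) : (C.phaseImage (cvec k)).sub (satDelta C) :=
  ⟨subset_sat C.lower (fun k => MCell.phase (cvec k)) k, subset_sat C.upper (fun k => MCell.phase (cvec k)) k⟩

/-- `C` is levelwise contained in its `G₁`-hull `satG1 C = satDelta (satPerm C)`. -/
theorem sub_satG1 (C : MConfig) : C.sub (satG1 C) := sub_trans (sub_satPerm C) (sub_satDelta _)

/-- a saturation by permutations is permutation-closed. -/
theorem permClosed_satPerm_level (S : Finset MCell) : PermClosed (univ.biUnion fun τ => S.image (MCell.perm τ)) := by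
  intro σ X hX
  obtain ⟨τ, Z, hZ, rfl⟩ := (mem_sat_iff S _ X).mp hX
  exact (mem_sat_iff S _ _).mpr ⟨τ * σ, Z, hZ, by rw [MCell.perm_mul]⟩

/-- `Δ` of a `(k,k,k,k)`-rotated cell is the `(k+1,…)`-rotated cell. -/
theorem delta_phase_cvec (Z : MCell) (k : Fin 4) : (Z.phase (cvec k)).delta = Z.phase (cvec (1 + k)) := by
  have h1 : (Z.phase (cvec k)).delta = (Z.phase (cvec k)).phase (cvec 1) := rfl
  rw [h1, ← MCell.phase_add]
  rfl

/-- a saturation by `⟨Δ⟩` is `Δ`-closed. -/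
theorem deltaClosed_satDelta_level (S : Finset MCell) : DeltaClosed (univ.biUnion fun k => S.image (MCell.phase (cvec k))) := by
  intro X hX
  obtain ⟨k, Z, hZ, rfl⟩ := (mem_sat_iff S _ X).mp hX
  exact (mem_sat_iff S _ _).mpr ⟨1 + k, Z, hZ, (delta_phase_cvec Z k).symm⟩

/-- permuting a constantly-rotated cell is rotating the permuted cell. -/
theorem perm_phase_cvec (σ : Equiv.Perm (Fin 4)) (k : Fin 4) (Z : MCell) : (Z.phase (cvec k)).perm σ = (Z.perm σ).phase (cvec k) :=
  rfl

/-- `⟨Δ⟩`-saturation keeps permutation-closedness. -/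
theorem permClosed_satDelta_level {S : Finset MCell} (hS : PermClosed S) :
    PermClosed (univ.biUnion fun k => S.image (MCell.phase (cvec k))) := by
  intro σ X hX
  obtain ⟨k, Z, hZ, rfl⟩ := (mem_sat_iff S _ X).mp hX
  exact (mem_sat_iff S _ _).mpr ⟨k, Z.perm σ, hS σ Z hZ, (perm_phase_cvec σ k Z).symm⟩

/-- **the hull is `G₁`-closed.** -/
theorem g1Closed_satG1 (C : MConfig) : (satG1 C).G1Closed :=
  ⟨permClosed_satDelta_level (permClosed_satPerm_level C.lower), permClosed_satDelta_level (permClosed_satPerm_level C.upper),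
    deltaClosed_satDelta_level _, deltaClosed_satDelta_level _⟩

/-- `S₄`-saturation keeps the diamond. -/
theorem inDiamond_satPerm {h : ℤ} {C : MConfig} (hU : C.InDiamond h) : (satPerm C).InDiamond h := by
  refine ⟨fun X hX => ?_, fun X hX => ?_⟩
  · obtain ⟨τ, Z, hZ, rfl⟩ := (mem_sat_iff C.lower _ X).mp hX; exact fun f => hU.1 Z hZ (τ f)
  · obtain ⟨τ, P, hP, rfl⟩ := (mem_sat_iff C.upper _ X).mp hX; exact fun f => hU.2 P hP (τ f)

/-- `⟨Δ⟩`-saturation keeps the diamond (tree: `MCell.inDiamond_phase_iff`). -/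
theorem inDiamond_satDelta {h : ℤ} {C : MConfig} (hU : C.InDiamond h) : (satDelta C).InDiamond h := by
  refine ⟨fun X hX => ?_, fun X hX => ?_⟩
  · obtain ⟨k, Z, hZ, rfl⟩ := (mem_sat_iff C.lower _ X).mp hX; exact (Z.inDiamond_phase_iff (cvec k) h).mpr (hU.1 Z hZ)
  · obtain ⟨k, P, hP, rfl⟩ := (mem_sat_iff C.upper _ X).mp hX; exact (P.inDiamond_phase_iff (cvec k) h).mpr (hU.2 P hP)

/-- **the hull lies in the same diamond.** -/
theorem inDiamond_satG1 {h : ℤ} {C : MConfig} (hU : C.InDiamond h) : (satG1 C).InDiamond h :=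
  inDiamond_satDelta (inDiamond_satPerm hU)

/-- **`S₄`-saturation keeps RULE-D closure** (covariance §2 + the tree's monotonicity `ruleDMu4N_mono` ∕ `ruleDMu4P_mono`). -/
theorem ruleDMu4Closed_satPerm {C : MConfig} (hR : RuleDMu4Closed C) : RuleDMu4Closed (satPerm C) := by
  refine ⟨fun X hX => ?_, fun X hX => ?_⟩
  · obtain ⟨τ, Z, hZ, rfl⟩ := (mem_sat_iff C.lower _ X).mp hX
    exact ruleDMu4N_mono (permImage_sub_satPerm C τ)
      (((ruleDMu4Closed_permImage τ C).mpr hR).1 _ ((perm_mem_permImage_lower τ C).mpr hZ))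
  · obtain ⟨τ, P, hP, rfl⟩ := (mem_sat_iff C.upper _ X).mp hX
    exact ruleDMu4P_mono (permImage_sub_satPerm C τ)
      (((ruleDMu4Closed_permImage τ C).mpr hR).2 _ ((perm_mem_permImage_upper τ C).mpr hP))

/-- **`⟨Δ⟩`-saturation keeps RULE-D closure** (LEMMA T's `ruleDMu4Closed_phaseImage` + monotonicity). -/
theorem ruleDMu4Closed_satDelta {C : MConfig} (hR : RuleDMu4Closed C) : RuleDMu4Closed (satDelta C) := by
  refine ⟨fun X hX => ?_, fun X hX => ?_⟩
  · obtain ⟨k, Z, hZ, rfl⟩ := (mem_sat_iff C.lower _ X).mp hX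
    exact ruleDMu4N_mono (phaseImage_sub_satDelta C k)
      (((ruleDMu4Closed_phaseImage (cvec k) C).mpr hR).1 _ (phase_mem_phaseImage_lower.mpr hZ))
  · obtain ⟨k, P, hP, rfl⟩ := (mem_sat_iff C.upper _ X).mp hX
    exact ruleDMu4P_mono (phaseImage_sub_satDelta C k)
      (((ruleDMu4Closed_phaseImage (cvec k) C).mpr hR).2 _ (phase_mem_phaseImage_upper.mpr hP))

/-- **the hull of a RULE-D-closed support is RULE-D-closed.** -/
theorem ruleDMu4Closed_satG1 {C : MConfig} (hR : RuleDMu4Closed C) : RuleDMu4Closed (satG1 C) :=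
  ruleDMu4Closed_satDelta (ruleDMu4Closed_satPerm hR)

/-- inclusion keeps the diamond downwards. -/
theorem inDiamond_sub {h : ℤ} {C D : MConfig} (hCD : C.sub D) (hU : D.InDiamond h) : C.InDiamond h :=
  ⟨fun Z hZ => hU.1 Z (hCD.1 hZ), fun P hP => hU.2 P (hCD.2 hP)⟩

/-- a permutation-closed support contains the `S₄`-saturation of each of its sub-supports. -/
theorem satPerm_sub {C D : MConfig} (hCD : C.sub D) (hl : PermClosed D.lower) (hu : PermClosed D.upper) : (satPerm C).sub D := by
  refine ⟨fun X hX => ?_, fun X hX => ?_⟩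
  · obtain ⟨τ, Z, hZ, rfl⟩ := (mem_sat_iff C.lower _ X).mp hX; exact hl τ Z (hCD.1 hZ)
  · obtain ⟨τ, P, hP, rfl⟩ := (mem_sat_iff C.upper _ X).mp hX; exact hu τ P (hCD.2 hP)

/-- iterating `Δ`: a `Δ`-closed level contains every constant rotation of each of its cells. -/
theorem phase_cvec_mem_of_deltaClosed {S : Finset MCell} (hS : DeltaClosed S) {Z : MCell} (hZ : Z ∈ S) (k : Fin 4) :
    Z.phase (cvec k) ∈ S := by
  have step : ∀ k : Fin 4, Z.phase (cvec k) ∈ S → Z.phase (cvec (1 + k)) ∈ S := fun k hk => by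
    rw [← delta_phase_cvec]; exact hS _ hk
  have h0 : Z.phase (cvec 0) ∈ S := hZ
  have h1 : Z.phase (cvec 1) ∈ S := step 0 h0
  have h2 : Z.phase (cvec 2) ∈ S := step 1 h1
  have h3 : Z.phase (cvec 3) ∈ S := step 2 h2
  fin_cases k
  exacts [h0, h1, h2, h3]

/-- a `Δ`-closed support contains the `⟨Δ⟩`-saturation of each of its sub-supports. -/
theorem satDelta_sub {C D : MConfig} (hCD : C.sub D) (hl : DeltaClosed D.lower) (hu : DeltaClosed D.upper) : (satDelta C).sub D := by
  refine ⟨fun X hX => ?_, fun X hX => ?_⟩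
  · obtain ⟨k, Z, hZ, rfl⟩ := (mem_sat_iff C.lower _ X).mp hX; exact phase_cvec_mem_of_deltaClosed hl (hCD.1 hZ) k
  · obtain ⟨k, P, hP, rfl⟩ := (mem_sat_iff C.upper _ X).mp hX; exact phase_cvec_mem_of_deltaClosed hu (hCD.2 hP) k

/-- **the hull is the LEAST `G₁`-closed support containing `C`** (with `sub_satG1` and `g1Closed_satG1`: `satG1` is the `G₁`-closure). -/
theorem satG1_sub {C D : MConfig} (hCD : C.sub D) (hG : D.G1Closed) : (satG1 C).sub D :=
  satDelta_sub (satPerm_sub hCD hG.1 hG.2.1) hG.2.2.1 hG.2.2.2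

/-- a `G₁`-closed support is its own hull (as a pair of finsets). -/
theorem satG1_eq_of_g1Closed {C : MConfig} (hG : C.G1Closed) : satG1 C = C := by
  have h₁ := satG1_sub (sub_refl C) hG
  have h₂ := sub_satG1 C
  cases C with
  | mk l u => exact congrArg₂ MConfig.mk (Finset.Subset.antisymm h₁.1 h₂.1) (Finset.Subset.antisymm h₁.2 h₂.2)


end Summit.Ventures.HSemireg.Pad4Tower
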